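/-
Public-domain reproduction (cell pub-lg7, seat 5).  The frame is Heath-Brown–Puchta's (2002, §6); no new mathematics.
This file is NOT a route to Goldbach, and no value of `K` is claimed in it: every analytic input is a named hypothesis.
-/
import Literature.NumberTheory.Sieve.GoldbachLinnikWeightTransfer

/-!
# Goldbach–Linnik by the direct route: `∫₀¹ A(α)² G_L(α)^K e(−Nα) dα > 0`
(Heath-Brown–Puchta's frame, §6 of their paper, over Pintz–Ruzsa-shaped minor arcs; the log-weighted count)

Topic `Literature/NumberTheory/Sieve`.  Companion of `GoldbachLinnikSeven.lean` (Pintz–Ruzsa's MIXED-MOMENT frame: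
variance of `r'_k`, Cauchy–Schwarz, the correlation constants `A(k)`) and of `GoldbachLinnikHBPCriterion.lean` (the closed
numerical inequalities `13.968 λ^{K−2} < 2.7895` of Heath-Brown–Puchta, with no analytic statement).  **THIS IS NOT A ROUTE
TO GOLDBACH, and no value of `K` is claimed here**: the file formalises the OTHER classical frame for Linnik's approximation
to Goldbach — the direct treatment of

  `r″_K(N; L) = Σ_{p + p' + 2^{ν₁} + ⋯ + 2^{ν_K} = N} (log p)(log p') = ∫₀¹ A_N(α)² G_L(α)^K e(−Nα) dα`

(`A_N(α) = Σ_{p ≤ N, p odd} (log p) e(pα)` = `GoldbachLinnik.oddPrimeLogSum`, `G_L(α) = Σ_{1 ≤ ν ≤ L} e(2^ν α)`), verbatim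
Heath-Brown–Puchta §6 ("Completion of the proof"): split `[0,1] = 𝔐 ∪ 𝔪`; on `𝔪 ∖ 𝒜_λ` (`𝒜_λ = {α : |G_L(α)| ≥ λL}`)
`|∫ A² G^K e(−αN)| ≤ (λL)^{K−2} ∫_𝔪 |A G_L|²`; on `𝔪 ∩ 𝒜_λ` the trivial bound times the measure; so
`r″_K(N; L) ≥ I_𝔐(N) − (λL)^{K−2} ∫_𝔪 |A G_L|² − |𝒜_λ ∩ [0,1]|·U²·L^K` (`|A| ≤ U` on `𝔪`), and the representation exists as
soon as the major arcs give `I_𝔐(N) ≥ (M − ε)·2NL^K` with `M > C λ^{K−2}` where `∫_𝔪 |A G_L|² ≤ (C + ε)·2NL²` — Heath-Brown–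
Puchta's "`13.968 λ^{K−2} < 2.7895`" in the normalisation of Pintz–Ruzsa (`C = C₂'` of Part I (1.10)/(8.9), `λ` of Part I
Theorem 3 / Corollary 2).  The length `L` of the power-of-two sum is a free parameter `L = L_N` (Heath-Brown–Puchta take
`L = [log(N/2K)/log 2]`, Pintz–Ruzsa II `L = [log₂N − √(log₂N)]`; the tree's `GoldbachLinnik.powSum` is the case
`L = ⌊log₂ N⌋`, `powSum_eq_powSumL`).

* §1 Objects: `powSumL`, `expTuplesL`, the weighted count `directCountW`, the major-arc integrals `majorArcDirectIntegral`
  (`Re ∫_{[0,1]∩𝔐} A² G_L^K e(−Nα)`) and `majorArcGoldbachIntegral` (`R^G_𝔐(N; n) = Re ∫_{[0,1]∩𝔐} A_N² e(−nα)`, the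
  major-arc piece of the weighted Goldbach count of `n`, used by the sequel `GoldbachLinnikDirectSeven.lean`).
* §2 The Fourier expansion `A² G_L^K = Σ (log p)(log p') e((p + p' + Σ2^{ν_i})α)` and orthogonality:
  `r″_K(N; L) = ∫₀¹ A² G_L^K e(−Nα)` (`directCountW_eq_integral`).
* §3 Heath-Brown–Puchta §6 for fixed `N` and arbitrary measurable `𝔐`, `E`: `majorArcDirectIntegral_le_directCountW_add`.
* §4 The frame `goldbach_linnik_with_of_direct_inputs`: hypotheses `hMaj` (major arcs in aggregate, the shape of
  Heath-Brown–Puchta's Lemma 7: `I_𝔐(N) ≥ (M − ε)2NL^K` for even `N`), `hS`/`hEU` (a sup bound `|A_N| ≤ U_N` off `𝔐_N`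
  coupled to the measure of the large-deviation set `E_N`, Pintz–Ruzsa I (10.6)), `hG` (`|G_L| ≤ λL` off `E_N`, Pintz–Ruzsa I
  Theorem 3 / Heath-Brown–Puchta Lemma 1), `hCi` (`∫_{[0,1]∖𝔐_N} |A_N G_L|² ≤ (C + ε)2NL²`, Pintz–Ruzsa I Lemma 10 / II
  Lemma 5 in the log-weighted normalisation of `GoldbachLinnikWeightTransferAsymptotic.lean`), criterion `C λ^{K−2} < M`
  ⇒ `goldbach_linnik_with K`.  The sequel derives `hMaj` from pointwise major arcs in the Goldbach form and a singular-series
  mean (Heath-Brown–Puchta §4 (20)–(25)), and records the numerical instances; here nothing numerical is asserted.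

## References

* D. R. Heath-Brown, J.-C. Puchta, *Integers represented as a sum of primes and powers of two*, Asian J. Math. 6 (2002)
  535–565 (arXiv:math/0201299): §1 (`S`, `T`, `L = [log(N/2K)/log 2]`, `𝒜_λ`), §6 (completion of the proof), Lemma 7.
  [HeathbrownPuchta2002]
* J. Pintz, I. Z. Ruzsa, *On Linnik's approximation to Goldbach's problem, I*, Acta Arith. 109 (2003) 169–194: (1.10),
  (8.4), (10.3)–(10.6), Theorem 3, Lemma 10. [PintzRuzsa2003]
* J. Pintz, I. Z. Ruzsa, *On Linnik's approximation to Goldbach's problem. II*, Acta Math. Hungar. 161 (2020) 569–582: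
  §2 (`L = [log₂N − √(log₂N)]`), Lemma 5. [PintzRuzsa2020]
* P. X. Gallagher, *Primes and powers of 2*, Invent. Math. 29 (1975) 125–142 (the frame `∫ S² T^K e(−αN)`). [Gallagher1975]
-/

noncomputable section

open scoped FourierTransform

open Finset Filter MeasureTheory

namespace Literature.NumberTheory.Sieve

namespace GoldbachLinnik

/-! ### §1 Objects -/

/-- `G_L(α) = Σ_{1 ≤ ν ≤ L} e(2^ν α)` for an arbitrary length `L` (Heath-Brown–Puchta's `T(α)`; Pintz–Ruzsa I (8.4) with
`L` free). [cite: HeathbrownPuchta2002, §1] -/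
def powSumL (L : ℕ) (α : ℝ) : ℂ := ∑ m ∈ Icc 1 L, (𝐞 (((2 ^ m : ℕ) : ℝ) * α) : ℂ)

/-- The tree's `G = G_{⌊log₂N⌋}` is `powSumL (powLen N)`. [cite: PintzRuzsa2003, (8.4)] -/
theorem powSum_eq_powSumL (N : ℕ) : powSum N = powSumL (powLen N) := rfl

/-- The exponent tuples `[1, L]^K`. [cite: HeathbrownPuchta2002, §4] -/
def expTuplesL (L K : ℕ) : Finset (Fin K → ℕ) := Fintype.piFinset fun _ => Icc 1 L

/-- The tree's `expTuples N k` is `expTuplesL (powLen N) k`. [cite: PintzRuzsa2003, (9.1)] -/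
theorem expTuples_eq_expTuplesL (N k : ℕ) : expTuples N k = expTuplesL (powLen N) k := rfl

/-- `#[1, L]^K = L^K`. [folklore] -/
theorem card_expTuplesL (L K : ℕ) : (expTuplesL L K).card = L ^ K := by
  rw [expTuplesL, Fintype.card_piFinset, Finset.prod_const, Nat.card_Icc, Finset.card_univ, Fintype.card_fin]
  simp

/-- Membership in `[1, L]^K`. [folklore] -/
theorem mem_expTuplesL {L K : ℕ} {ν : Fin K → ℕ} : ν ∈ expTuplesL L K ↔ ∀ i, 1 ≤ ν i ∧ ν i ≤ L := by
  simp [expTuplesL, Fintype.mem_piFinset]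

/-- For `ν ∈ [1, L]^K`: `2^{ν₁} + ⋯ + 2^{ν_K} ≤ K·2^L`. [folklore] -/
theorem tupleSum_le_of_mem {L K : ℕ} {ν : Fin K → ℕ} (hν : ν ∈ expTuplesL L K) : tupleSum ν ≤ K * 2 ^ L := by
  rw [mem_expTuplesL] at hν
  calc tupleSum ν = ∑ i, 2 ^ ν i := rfl
    _ ≤ ∑ _i : Fin K, 2 ^ L := Finset.sum_le_sum fun i _ => Nat.pow_le_pow_right two_pos (hν i).2
    _ = K * 2 ^ L := by simp

/-- For `ν ∈ [1, L]^K` the sum `2^{ν₁} + ⋯ + 2^{ν_K}` is even (all exponents are `≥ 1`). [folklore] -/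
theorem even_tupleSum_of_mem {L K : ℕ} {ν : Fin K → ℕ} (hν : ν ∈ expTuplesL L K) : Even (tupleSum ν) := by
  rw [mem_expTuplesL] at hν
  refine Finset.even_sum _ fun i _ => ?_
  exact (Nat.even_pow' (by have := (hν i).1; omega)).2 even_two

/-- **The weighted direct count** `r″_K(N; L) = Σ (log p)(log p')` over the solutions of
`p + p' + 2^{ν₁} + ⋯ + 2^{ν_K} = N` in odd primes `p, p' ≤ N` and `ν ∈ [1, L]^K` (Heath-Brown–Puchta's `R(N)` with
log weights on the primes, Gallagher's frame). [cite: HeathbrownPuchta2002, §6] -/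
def directCountW (N L K : ℕ) : ℝ :=
  ∑ x ∈ ((oddPrimes N ×ˢ oddPrimes N) ×ˢ expTuplesL L K).filter (fun x => x.1.1 + x.1.2 + tupleSum x.2 = N),
    Real.log x.1.1 * Real.log x.1.2

/-- **The major-arc piece of the direct integral**, `I_𝔐(N; L, K) = Re ∫_{[0,1]∩𝔐} A_N(α)² G_L(α)^K e(−Nα) dα`
(left side of Heath-Brown–Puchta's Lemma 7, for an arbitrary set `𝔐`). [cite: HeathbrownPuchta2002, Lemma 7] -/
def majorArcDirectIntegral (𝔐 : Set ℝ) (N L K : ℕ) : ℝ :=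
  (∫ α in Set.Icc (0 : ℝ) 1 ∩ 𝔐,
    oddPrimeLogSum N α ^ 2 * powSumL L α ^ K * (𝐞 (-(N : ℝ) * α) : ℂ)).re

/-- **The major-arc piece of the weighted Goldbach count of `n` at height `N`**,
`R^G_𝔐(N; n) = Re ∫_{[0,1]∩𝔐} A_N(α)² e(−nα) dα` (Heath-Brown–Puchta §4 (16)–(20), there with `S` in place of `A_N`;
for an arbitrary set `𝔐`). [cite: HeathbrownPuchta2002, §4 (20)] -/
def majorArcGoldbachIntegral (𝔐 : Set ℝ) (N n : ℕ) : ℝ :=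
  (∫ α in Set.Icc (0 : ℝ) 1 ∩ 𝔐, oddPrimeLogSum N α ^ 2 * (𝐞 (-(n : ℝ) * α) : ℂ)).re

/-! ### §2 Pointwise facts, the Fourier expansion and orthogonality -/

/-- `G_L` is continuous. [folklore] -/
theorem continuous_powSumL (L : ℕ) : Continuous (powSumL L) :=
  continuous_finsetSum _ fun _ _ => continuous_fourierChar_mul _

/-- The trivial bound `|G_L(α)| ≤ L`. [cite: PintzRuzsa2003, (10.6)] -/
theorem norm_powSumL_le (L : ℕ) (α : ℝ) : ‖powSumL L α‖ ≤ L := by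
  refine (norm_sum_le _ _).trans (le_of_eq ?_)
  rw [Finset.sum_congr rfl fun p _ => Circle.norm_coe _, Finset.sum_const, nsmul_eq_mul, mul_one, Nat.card_Icc]
  simp

/-- `G_L(α)^K = Σ_{ν ∈ [1,L]^K} e((2^{ν₁} + ⋯ + 2^{ν_K}) α)`. [cite: PintzRuzsa2003, (10.3)] -/
theorem powSumL_pow (L K : ℕ) (α : ℝ) :
    powSumL L α ^ K = ∑ ν ∈ expTuplesL L K, (𝐞 (((tupleSum ν : ℕ) : ℝ) * α) : ℂ) := by
  rw [← Fin.prod_const K (powSumL L α)]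
  simp only [powSumL]
  rw [Finset.prod_univ_sum]
  refine Finset.sum_congr rfl fun ν _ => ?_
  rw [← fourierChar_sum_coe]
  congr 2
  unfold tupleSum
  push_cast
  rw [Finset.sum_mul]

/-- **The Fourier expansion of the integrand**:
`A_N(α)² G_L(α)^K = Σ_{(p, p', ν)} (log p)(log p') e((p + p' + 2^{ν₁} + ⋯ + 2^{ν_K}) α)` over odd primes
`p, p' ≤ N` and `ν ∈ [1, L]^K`. [cite: HeathbrownPuchta2002, §6] -/
theorem oddPrimeLogSum_sq_mul_powSumL_pow (N L K : ℕ) (α : ℝ) :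
    oddPrimeLogSum N α ^ 2 * powSumL L α ^ K =
      ∑ x ∈ (oddPrimes N ×ˢ oddPrimes N) ×ˢ expTuplesL L K,
        ((Real.log x.1.1 * Real.log x.1.2 : ℝ) : ℂ) *
          (𝐞 (((x.1.1 + x.1.2 + tupleSum x.2 : ℕ) : ℝ) * α) : ℂ) := by
  rw [Finset.sum_product, Finset.sum_product, sq, oddPrimeLogSum, powSumL_pow, Finset.sum_mul_sum,
    Finset.sum_mul]
  refine Finset.sum_congr rfl fun p _ => ?_
  rw [Finset.sum_mul]
  refine Finset.sum_congr rfl fun q _ => ?_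
  rw [Finset.mul_sum]
  refine Finset.sum_congr rfl fun ν _ => ?_
  have he : (𝐞 (((p + q + tupleSum ν : ℕ) : ℝ) * α) : ℂ) =
      (𝐞 ((p : ℝ) * α) : ℂ) * 𝐞 ((q : ℝ) * α) * 𝐞 (((tupleSum ν : ℕ) : ℝ) * α) := by
    rw [← fourierChar_add_coe, ← fourierChar_add_coe]
    congr 2
    push_cast
    ring
  rw [he]
  push_cast
  ring

/-- **Orthogonality with weights**: for a finite family of natural-number frequencies `f` and real weights `c`,
`∫₀¹ (Σ_x c_x e(f(x)α)) e(−nα) dα = Σ_{x : f(x) = n} c_x`, by `∫₀¹ e(mα) dα = [m = 0]`. [cite: VaughanHL1997, §1.2 eq. (1.4)] -/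
theorem integral_expSum_mul_fourierChar_neg {β : Type*} (X : Finset β) (c : β → ℝ) (f : β → ℕ) (n : ℕ) :
    ∫ α in (0 : ℝ)..1, (∑ x ∈ X, ((c x : ℝ) : ℂ) * (𝐞 ((f x : ℝ) * α) : ℂ)) * (𝐞 (-(n : ℝ) * α) : ℂ) =
      ((∑ x ∈ X.filter (fun x => f x = n), c x : ℝ) : ℂ) := by
  have horth : ∀ m : ℤ, ∫ α in (0 : ℝ)..1, (𝐞 (m * α) : ℂ) = if m = 0 then 1 else 0 :=
    integral_fourierChar_intCast_holds
  have hterm : ∀ (x : β) (α : ℝ), ((c x : ℝ) : ℂ) * (𝐞 ((f x : ℝ) * α) : ℂ) * (𝐞 (-(n : ℝ) * α) : ℂ) =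
      ((c x : ℝ) : ℂ) * (𝐞 ((((f x : ℤ) - n : ℤ) : ℝ) * α) : ℂ) := by
    intro x α
    rw [mul_assoc, ← fourierChar_add_coe]
    congr 3
    push_cast
    ring
  have hcont : ∀ x : β, Continuous fun α : ℝ => ((c x : ℝ) : ℂ) * (𝐞 ((((f x : ℤ) - n : ℤ) : ℝ) * α) : ℂ) :=
    fun x => continuous_const.mul (continuous_fourierChar_mul _)
  simp_rw [Finset.sum_mul, hterm]
  rw [intervalIntegral.integral_finsetSum fun x _ => (hcont x).intervalIntegrable _ _]
  simp_rw [intervalIntegral.integral_const_mul, horth, sub_eq_zero, Nat.cast_inj]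
  rw [Finset.sum_filter]
  push_cast
  exact Finset.sum_congr rfl fun x _ => by split_ifs <;> simp

/-- **Gallagher's identity for the direct count**: `r″_K(N; L) = ∫₀¹ A_N(α)² G_L(α)^K e(−Nα) dα`.
[cite: HeathbrownPuchta2002, §6] -/
theorem directCountW_eq_integral (N L K : ℕ) :
    ((directCountW N L K : ℝ) : ℂ) =
      ∫ α in (0 : ℝ)..1, oddPrimeLogSum N α ^ 2 * powSumL L α ^ K * (𝐞 (-(N : ℝ) * α) : ℂ) := by
  have h := integral_expSum_mul_fourierChar_neg ((oddPrimes N ×ˢ oddPrimes N) ×ˢ expTuplesL L K)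
    (fun x => Real.log x.1.1 * Real.log x.1.2) (fun x => x.1.1 + x.1.2 + tupleSum x.2) N
  rw [directCountW, ← h]
  refine intervalIntegral.integral_congr fun α _ => ?_
  simp only [oddPrimeLogSum_sq_mul_powSumL_pow]

/-! ### §3 Heath-Brown–Puchta §6 for fixed `N`: major arcs ≤ count + the two minor-arc pieces -/

/-- **Heath-Brown–Puchta §6, for fixed `N` and arbitrary measurable `𝔐`, `E`** (`K ≥ 2`): if `|A_N| ≤ U` on `[0,1] ∖ 𝔐`
and `|G_L| ≤ λL` on `[0,1] ∖ E`, then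
`I_𝔐(N; L, K) ≤ r″_K(N; L) + |E ∩ [0,1]|·U²·L^K + (λL)^{K−2} ∫_{[0,1]∖𝔐} |A_N G_L|²`
(the real part of `∫₀¹ = ∫_𝔐 + ∫_{𝔪∩E} + ∫_{𝔪∖E}` with `|∫_{𝔪∩E}| ≤ |E|U²L^K` and
`|∫_{𝔪∖E} A²G^K e(−αN)| ≤ (λL)^{K−2}∫_𝔪|AG|²`). [cite: HeathbrownPuchta2002, §6] -/
theorem majorArcDirectIntegral_le_directCountW_add {𝔐 E : Set ℝ} (h𝔐 : MeasurableSet 𝔐)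
    (hE : MeasurableSet E) (N L : ℕ) {K : ℕ} (hK : 2 ≤ K) {U lam : ℝ} (hlam : 0 ≤ lam)
    (hS : ∀ α ∈ Set.Icc (0 : ℝ) 1 \ 𝔐, ‖oddPrimeLogSum N α‖ ≤ U)
    (hG : ∀ α ∈ Set.Icc (0 : ℝ) 1 \ E, ‖powSumL L α‖ ≤ lam * L) :
    majorArcDirectIntegral 𝔐 N L K ≤ directCountW N L K +
      (volume (E ∩ Set.Icc (0 : ℝ) 1)).toReal * U ^ 2 * (L : ℝ) ^ K +
      (lam * L) ^ (K - 2) * ∫ α in Set.Icc (0 : ℝ) 1 \ 𝔐, ‖oddPrimeLogSum N α * powSumL L α‖ ^ 2 := by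
  set F : ℝ → ℂ := fun α =>
    oddPrimeLogSum N α ^ 2 * powSumL L α ^ K * (𝐞 (-(N : ℝ) * α) : ℂ) with hF
  have hFc : Continuous F :=
    (((continuous_oddPrimeLogSum N).pow 2).mul ((continuous_powSumL L).pow K)).mul
      (continuous_fourierChar_mul _)
  have hI : IntegrableOn F (Set.Icc (0 : ℝ) 1) := hFc.integrableOn_Icc
  -- (1) the count is `∫_{[0,1]} F`, which splits over `𝔐`
  have h1 : ((directCountW N L K : ℝ) : ℂ) = ∫ α in Set.Icc (0 : ℝ) 1, F α := by
    rw [directCountW_eq_integral, intervalIntegral.integral_of_le zero_le_one, integral_Icc_eq_integral_Ioc]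
  have h2 : ∫ α in Set.Icc (0 : ℝ) 1, F α =
      (∫ α in Set.Icc (0 : ℝ) 1 ∩ 𝔐, F α) + ∫ α in Set.Icc (0 : ℝ) 1 \ 𝔐, F α := by
    conv_lhs => rw [← Set.inter_union_sdiff (Set.Icc (0 : ℝ) 1) 𝔐]
    rw [setIntegral_union (Set.disjoint_sdiff_right.mono_left Set.inter_subset_right)
      (measurableSet_Icc.diff h𝔐) (hI.mono_set Set.inter_subset_left) (hI.mono_set Set.sdiff_subset)]
  have h3 : directCountW N L K =
      majorArcDirectIntegral 𝔐 N L K + (∫ α in Set.Icc (0 : ℝ) 1 \ 𝔐, F α).re := by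
    have h := congrArg Complex.re (h1.trans h2)
    rw [Complex.ofReal_re, Complex.add_re] at h
    exact h
  -- (2) the minor-arc integral is at least `-∫ ‖F‖`
  have h4 : -(∫ α in Set.Icc (0 : ℝ) 1 \ 𝔐, ‖F α‖) ≤ (∫ α in Set.Icc (0 : ℝ) 1 \ 𝔐, F α).re := by
    have ha := Complex.abs_re_le_norm (∫ α in Set.Icc (0 : ℝ) 1 \ 𝔐, F α)
    have hb := norm_integral_le_integral_norm (μ := volume.restrict (Set.Icc (0 : ℝ) 1 \ 𝔐)) F
    rw [abs_le] at ha
    linarith [ha.1]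
  have hnormF : ∀ α, ‖F α‖ = ‖oddPrimeLogSum N α‖ ^ 2 * ‖powSumL L α‖ ^ K := by
    intro α
    rw [hF]
    simp only [norm_mul, norm_pow, Circle.norm_coe, mul_one]
  have hIn : IntegrableOn (fun α => ‖F α‖) (Set.Icc (0 : ℝ) 1) := (continuous_norm.comp hFc).integrableOn_Icc
  -- (3) split the minor arcs over `E`
  have h6 : ∫ α in Set.Icc (0 : ℝ) 1 \ 𝔐, ‖F α‖ =
      (∫ α in (Set.Icc (0 : ℝ) 1 \ 𝔐) ∩ E, ‖F α‖) + ∫ α in (Set.Icc (0 : ℝ) 1 \ 𝔐) \ E, ‖F α‖ := by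
    conv_lhs => rw [← Set.inter_union_sdiff (Set.Icc (0 : ℝ) 1 \ 𝔐) E]
    rw [setIntegral_union (Set.disjoint_sdiff_right.mono_left Set.inter_subset_right)
      ((measurableSet_Icc.diff h𝔐).diff hE)
      (hIn.mono_set (Set.inter_subset_left.trans Set.sdiff_subset))
      (hIn.mono_set (Set.sdiff_subset.trans Set.sdiff_subset))]
  -- (4) on `E`: the trivial bound times the measure (Pintz–Ruzsa I (10.6))
  have h7 : ∫ α in (Set.Icc (0 : ℝ) 1 \ 𝔐) ∩ E, ‖F α‖ ≤
      (volume (E ∩ Set.Icc (0 : ℝ) 1)).toReal * U ^ 2 * (L : ℝ) ^ K := by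
    set B : Set ℝ := (Set.Icc (0 : ℝ) 1 \ 𝔐) ∩ E
    have hBfin : volume B < ⊤ :=
      (measure_mono (Set.inter_subset_left.trans Set.sdiff_subset)).trans_lt (by simp [Real.volume_Icc])
    have hbound : ∀ α ∈ B, ‖‖F α‖‖ ≤ U ^ 2 * (L : ℝ) ^ K := by
      intro α hα
      rw [norm_norm, hnormF]
      have hU0 : 0 ≤ U := (norm_nonneg _).trans (hS α hα.1)
      exact mul_le_mul (pow_le_pow_left₀ (norm_nonneg _) (hS α hα.1) 2)
        (pow_le_pow_left₀ (norm_nonneg _) (norm_powSumL_le L α) K) (by positivity) (by positivity)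
    have h := norm_setIntegral_le_of_norm_le_const hBfin hbound
    rw [Real.norm_of_nonneg (integral_nonneg fun _ => norm_nonneg _)] at h
    refine h.trans ?_
    have hvol : (volume B).toReal ≤ (volume (E ∩ Set.Icc (0 : ℝ) 1)).toReal := by
      refine ENNReal.toReal_mono ?_ (measure_mono fun α hα => ⟨hα.2, hα.1.1⟩)
      exact ((measure_mono Set.inter_subset_right).trans_lt (by simp [Real.volume_Icc])).ne
    have hUL : 0 ≤ U ^ 2 * (L : ℝ) ^ K := by positivity
    calc U ^ 2 * (L : ℝ) ^ K * (volume B).toReal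
        ≤ U ^ 2 * (L : ℝ) ^ K * (volume (E ∩ Set.Icc (0 : ℝ) 1)).toReal := mul_le_mul_of_nonneg_left hvol hUL
      _ = _ := by ring
  -- (5) off `E`: `|A|²|G|^K ≤ (λL)^{K-2} |A G|²` (Pintz–Ruzsa I (10.5))
  have h8 : ∫ α in (Set.Icc (0 : ℝ) 1 \ 𝔐) \ E, ‖F α‖ ≤
      (lam * L) ^ (K - 2) * ∫ α in Set.Icc (0 : ℝ) 1 \ 𝔐, ‖oddPrimeLogSum N α * powSumL L α‖ ^ 2 := by
    set C : Set ℝ := (Set.Icc (0 : ℝ) 1 \ 𝔐) \ E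
    have hCm : MeasurableSet C := (measurableSet_Icc.diff h𝔐).diff hE
    have hsub : C ⊆ Set.Icc (0 : ℝ) 1 := Set.sdiff_subset.trans Set.sdiff_subset
    have hcont1 : Continuous fun α : ℝ => ‖oddPrimeLogSum N α * powSumL L α‖ ^ 2 :=
      (continuous_norm.comp ((continuous_oddPrimeLogSum N).mul (continuous_powSumL L))).pow 2
    have hpt : ∀ α ∈ C, ‖F α‖ ≤ (lam * L) ^ (K - 2) * ‖oddPrimeLogSum N α * powSumL L α‖ ^ 2 := by
      intro α hα
      have hGα : ‖powSumL L α‖ ≤ lam * L := hG α ⟨hsub hα, hα.2⟩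
      obtain ⟨j, rfl⟩ : ∃ j, K = j + 2 := ⟨K - 2, by omega⟩
      have hj := pow_le_pow_left₀ (norm_nonneg _) hGα j
      rw [hnormF, Nat.add_sub_cancel]
      calc ‖oddPrimeLogSum N α‖ ^ 2 * ‖powSumL L α‖ ^ (j + 2)
          = ‖powSumL L α‖ ^ j * ‖oddPrimeLogSum N α * powSumL L α‖ ^ 2 := by
            rw [norm_mul, mul_pow, pow_add]
            ring
        _ ≤ (lam * L) ^ j * ‖oddPrimeLogSum N α * powSumL L α‖ ^ 2 :=
          mul_le_mul_of_nonneg_right hj (sq_nonneg _)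
    calc ∫ α in C, ‖F α‖
        ≤ ∫ α in C, (lam * L) ^ (K - 2) * ‖oddPrimeLogSum N α * powSumL L α‖ ^ 2 :=
          setIntegral_mono_on (hIn.mono_set hsub) ((hcont1.integrableOn_Icc.mono_set hsub).const_mul _) hCm hpt
      _ = (lam * L) ^ (K - 2) * ∫ α in C, ‖oddPrimeLogSum N α * powSumL L α‖ ^ 2 :=
          integral_const_mul _ _
      _ ≤ (lam * L) ^ (K - 2) * ∫ α in Set.Icc (0 : ℝ) 1 \ 𝔐, ‖oddPrimeLogSum N α * powSumL L α‖ ^ 2 := by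
          refine mul_le_mul_of_nonneg_left ?_ (by positivity)
          exact setIntegral_mono_set (hcont1.integrableOn_Icc.mono_set Set.sdiff_subset)
            (Eventually.of_forall fun _ => sq_nonneg _) (Eventually.of_forall Set.sdiff_subset)
  linarith [h3, h4, h6, h7, h8]

/-- A positive weighted count yields a representation `N = p + q + 2^{ν₁} + ⋯ + 2^{ν_K}` with `p, q` (odd) primes.
[folklore] -/
theorem exists_rep_of_directCountW_pos {N L K : ℕ} (h : 0 < directCountW N L K) :
    ∃ (p q : ℕ) (e : Fin K → ℕ), p.Prime ∧ q.Prime ∧ p + q + ∑ i, 2 ^ e i = N := by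
  obtain ⟨x, hx⟩ := Finset.nonempty_of_sum_ne_zero h.ne'
  rw [Finset.mem_filter, Finset.mem_product, Finset.mem_product] at hx
  obtain ⟨⟨⟨hp, hq⟩, -⟩, hsum⟩ := hx
  exact ⟨x.1.1, x.1.2, x.2, (mem_oddPrimes.1 hp).2.1, (mem_oddPrimes.1 hq).2.1, hsum⟩

/-! ### §4 The frame: Heath-Brown–Puchta §6 over named inputs -/

/-- **`goldbach_linnik_with K` by the direct route (Heath-Brown–Puchta §6, in Pintz–Ruzsa's normalisation).**  Let
`K ≥ 2`, `L_N ≥ 1` eventually, `𝔐_N`, `E_N` measurable.  Hypotheses (all eventually in `N`, `∀ ε > 0` where stated):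
* `hMaj` — MAJOR ARCS IN AGGREGATE (the shape of Heath-Brown–Puchta's Lemma 7): for even `N`,
  `Re ∫_{[0,1]∩𝔐_N} A_N² G_{L_N}^K e(−Nα) ≥ (M − ε)·2N L_N^K`;
* `hS`, `hEU` — a sup bound `|A_N| ≤ U_N` on `[0,1] ∖ 𝔐_N` with `|E_N ∩ [0,1]|·U_N² ≤ εN` (Pintz–Ruzsa I (10.6): Vinogradov
  / (2.10) with the large-deviation measure bound of Theorem 3);
* `hG` — `|G_{L_N}| ≤ λ L_N` on `[0,1] ∖ E_N` (Pintz–Ruzsa I Theorem 3 / Corollary 2; Heath-Brown–Puchta Lemma 1);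
* `hCi` — `∫_{[0,1]∖𝔐_N} |A_N G_{L_N}|² ≤ (C + ε)·2N L_N²` (Pintz–Ruzsa I Lemma 10 / II Lemma 5, log-weighted normalisation);
and the criterion `C λ^{K−2} < M` (Heath-Brown–Puchta: "`13.968 λ^{K−2} < 2.7895`").  Then every large even `N` is a sum of
two primes and `K` powers of two.  Proof: `majorArcDirectIntegral_le_directCountW_add` with `ε = (M − Cλ^{K−2})/(3 + 2λ^{K−2})`
gives `r″_K(N; L_N) ≥ (M − Cλ^{K−2})·N L_N^K > 0`. [cite: HeathbrownPuchta2002, §6] -/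
theorem goldbach_linnik_with_of_direct_inputs {K : ℕ} (hK : 2 ≤ K) {Lf : ℕ → ℕ} {𝔐 E : ℕ → Set ℝ}
    (h𝔐 : ∀ N, MeasurableSet (𝔐 N)) (hE : ∀ N, MeasurableSet (E N)) {U : ℕ → ℝ} {M C lam : ℝ}
    (hlam : 0 ≤ lam) (hcrit : C * lam ^ (K - 2) < M)
    (hL : ∀ᶠ N : ℕ in atTop, 1 ≤ Lf N)
    (hMaj : ∀ ε : ℝ, 0 < ε → ∀ᶠ N : ℕ in atTop, Even N →
      (M - ε) * (2 * N * (Lf N : ℝ) ^ K) ≤ majorArcDirectIntegral (𝔐 N) N (Lf N) K)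
    (hS : ∀ᶠ N : ℕ in atTop, ∀ α ∈ Set.Icc (0 : ℝ) 1 \ 𝔐 N, ‖oddPrimeLogSum N α‖ ≤ U N)
    (hEU : ∀ ε : ℝ, 0 < ε → ∀ᶠ N : ℕ in atTop,
      (volume (E N ∩ Set.Icc (0 : ℝ) 1)).toReal * U N ^ 2 ≤ ε * N)
    (hG : ∀ᶠ N : ℕ in atTop, ∀ α ∈ Set.Icc (0 : ℝ) 1 \ E N, ‖powSumL (Lf N) α‖ ≤ lam * Lf N)
    (hCi : ∀ ε : ℝ, 0 < ε → ∀ᶠ N : ℕ in atTop,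
      ∫ α in Set.Icc (0 : ℝ) 1 \ 𝔐 N, ‖oddPrimeLogSum N α * powSumL (Lf N) α‖ ^ 2 ≤
        (C + ε) * (2 * N * (Lf N : ℝ) ^ 2)) :
    goldbach_linnik_with K := by
  have hpos : ∀ᶠ N : ℕ in atTop, Even N → 0 < directCountW N (Lf N) K := by
    have hden : 0 < 3 + 2 * lam ^ (K - 2) := by positivity
    obtain ⟨ε, hε0, hεkey⟩ : ∃ ε : ℝ, 0 < ε ∧ ε * (3 + 2 * lam ^ (K - 2)) = M - C * lam ^ (K - 2) :=
      ⟨(M - C * lam ^ (K - 2)) / (3 + 2 * lam ^ (K - 2)), div_pos (by linarith) hden,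
        div_mul_cancel₀ _ hden.ne'⟩
    filter_upwards [hL, hMaj ε hε0, hS, hEU ε hε0, hG, hCi ε hε0, eventually_ge_atTop 1]
      with N hLN hMajN hSN hEUN hGN hCiN hN1 hev
    have hsplit := majorArcDirectIntegral_le_directCountW_add (h𝔐 N) (hE N) N (Lf N) hK hlam hSN hGN
    have hNpos : (0 : ℝ) < N := by exact_mod_cast hN1
    have hLpos : (0 : ℝ) < Lf N := by exact_mod_cast hLN
    have hpow : (lam * Lf N) ^ (K - 2) * (2 * N * (Lf N : ℝ) ^ 2) = lam ^ (K - 2) * (2 * N * (Lf N : ℝ) ^ K) := by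
      have hLK : (Lf N : ℝ) ^ (K - 2) * (Lf N : ℝ) ^ 2 = (Lf N : ℝ) ^ K := by
        rw [← pow_add, Nat.sub_add_cancel hK]
      rw [mul_pow, ← hLK]
      ring
    have hT3 : (lam * Lf N) ^ (K - 2) *
        ∫ α in Set.Icc (0 : ℝ) 1 \ 𝔐 N, ‖oddPrimeLogSum N α * powSumL (Lf N) α‖ ^ 2 ≤
        (C + ε) * (lam ^ (K - 2) * (2 * N * (Lf N : ℝ) ^ K)) := by
      calc _ ≤ (lam * Lf N) ^ (K - 2) * ((C + ε) * (2 * N * (Lf N : ℝ) ^ 2)) :=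
            mul_le_mul_of_nonneg_left hCiN (by positivity)
        _ = (C + ε) * ((lam * Lf N) ^ (K - 2) * (2 * N * (Lf N : ℝ) ^ 2)) := by ring
        _ = _ := by rw [hpow]
    have hT2 : (volume (E N ∩ Set.Icc (0 : ℝ) 1)).toReal * U N ^ 2 * (Lf N : ℝ) ^ K ≤
        ε * N * (Lf N : ℝ) ^ K :=
      mul_le_mul_of_nonneg_right hEUN (by positivity)
    have hmain := hMajN hev
    have hbr : (M - ε) - ε / 2 - (C + ε) * lam ^ (K - 2) = (M - C * lam ^ (K - 2)) / 2 := by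
      linear_combination (-1 / 2 : ℝ) * hεkey
    have hδ : 0 < (M - C * lam ^ (K - 2)) / 2 * (2 * N * (Lf N : ℝ) ^ K) :=
      mul_pos (div_pos (by linarith) two_pos) (by positivity)
    have key : ((M - ε) - ε / 2 - (C + ε) * lam ^ (K - 2)) * (2 * N * (Lf N : ℝ) ^ K) ≤
        directCountW N (Lf N) K := by
      linarith [hsplit, hT3, hT2, hmain]
    rw [hbr] at key
    exact hδ.trans_le key
  obtain ⟨N₀, hN₀⟩ := Filter.eventually_atTop.1 hpos
  refine ⟨N₀, fun N hN hNe => ?_⟩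
  obtain ⟨p, q, e, hp, hq, hsum⟩ := exists_rep_of_directCountW_pos (hN₀ N hN hNe)
  exact ⟨p, q, K, e, hp, hq, le_rfl, hsum⟩

end GoldbachLinnik

end Literature.NumberTheory.Sieve
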